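import Literature.MathematicalPhysics.QuantumFieldTheory.Balaban1983to89.LatticeFieldCalculus
import Literature.MathematicalPhysics.QuantumFieldTheory.Balaban1983to89.B5Eq118OneStroke

/-!
# `Balaban1983to89.B5Eq120IterProof` — T. Bałaban, *Propagators and renormalization transformations for lattice gauge
theories. I*, Commun. Math. Phys. **95** (1984) 17–40 [Balaban1984PropagatorsI]: the gauge covariance of the linear averages,
(1.9) p. 19 for the full average `B` of (1.8), (1.13) p. 19 for `Q`, and the `k`-step form (1.20) p. 20 `Q_k A^λ = Q_k A − ∂Q'_k λ` — PROVED

statement-level skeleton of published theorems with citation tags; proofs where landed; nothing here is a claim about the Yang–Mills mass gap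

PDF held: `paper:balaban1984-cmp95-propagators-rt-i` (journal page = PDF page + 16).  Displays read as images by this seat from the ×2
renders `run/shared/lean/pub/pub-balaban/b2b-balaban-ref1/pages/1984-cmp95-propagators-rt-I/1984-cmp95-propagators-rt-I-p003-x2.png` (p. 19)
and `…-p004-x2.png` (p. 20).

PRINT, verbatim.  p. 19: "If we make a gauge transformation `λ`, then for the averaged field `B` we have
`B^λ_c = B_c − L⁻¹(λ(c₊) − λ(c₋)) = B_c − (∂λ)(c)`, (1.9)"; "We may define the averaging operation as given by `Q` directly. Then
the average field `B` transforms as `B^λ_c = B_c − L⁻¹(Σ_{x∈B(c₊)} L^{−d}λ(x) − Σ_{x∈B(c₋)} L^{−d}λ(x)) = B_c − L⁻¹((Q'λ)(c₊) − (Q'λ)(c₋))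
= B_c − (∂Q'λ)(c)`. (1.13)".  p. 20: "Under a gauge transformation `λ` the field `A` and the averaged field `Q_kA` transform as follows
`A^λ = A − ∂^ηλ`, `(Q_kA^λ)_b = (Q_kA)_b − (Σ_{x∈B^k(b₊)} η^dλ(x) − Σ_{x∈B^k(b₋)} η^dλ(x))`, `b ⊂ T₁^{(k)}`, (1.20) or denoting
`(Q'_kλ)(y) = Σ_{x∈B^k(y)} η^dλ(x)`, we have `Q_kA^λ = Q_kA − ∂Q'_kλ`.  The δ-function `δ(B − Q_kA)` is invariant with respect to gauge
transformations `λ` satisfying `Q'_kλ = 0`" (`η = L^{−k}`, (1.18)).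

CITATION HEADER (lean-in-tree rule).  Phase-2 PROOF file of the lit-balaban typed skeleton (HOME `run/shared/lean/pub/lit-balaban/`), seat
p38, SKELETON.md row `B5.Eq1.9-1.20` (reader r18, id A04; PHASE2-TARGETS.md §G.3 line p38).  WHAT IS REPRODUCED, over the carriers OF RECORD of
`…Balaban1983to89.LatticeFieldCalculus` (unit r18: `grad`, `gaugeShift`, `segSum`, `runSum`, `stairSum`, `siteAvg`, `bondAvg`, `siteAvgIter`,
`bondAvgIter`, `fullBondAvg`; the one-step identity (1.13) `bondAvg_gaugeShift` is ALREADY PROVED there and is not restated):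
* (1.9): the sum of a gradient along the signed straight runs and along the staircase contour `Γ_{y,x}` telescopes (`runSum_grad`,
  `stairSum_grad`), hence the FULL linear average (1.8) of `∂λ` is the coarse gradient of `λ` restricted to the coarse sites
  (`fullBondAvg_grad`) and `B^λ_c = B_c − (c/L)(λ(c₊) − λ(c₋))` (`fullBondAvg_gaugeShift`, display form `eq19`);
* (1.13) in its displayed block-sum form (`eq113_blockSum`, from `bondAvg_gaugeShift` and `siteAvg_eq_blockSum`);
* (1.20): `Q_k∂ = ∂Q'_k` with the coarse lattice factor `c/L^k` (`bondAvgIter_grad`), `Q_kA^λ = Q_kA − ∂Q'_kλ` (`bondAvgIter_gaugeShift`,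
  display form `eq120`; at the printed normalisation `c = η⁻¹ = L^k`, unit coarse lattice, `eq120_unit`), and the closing sentence: `Q_kA^λ = Q_kA`
  whenever `Q'_kλ = 0` (`bondAvgIter_gaugeShift_of_null`) — by induction on `k` over the `k`-fold composites `bondAvgIter`/`siteAvgIter`.
Conventions as in `LatticeFieldCalculus` (NOTATION §2.2 of `pub-balaban`): the lattice factor `c` of `∂` is an explicit real parameter (`η⁻¹` in
print), one averaging step divides it by `L`; blocks are the CENTRED blocks of `Setup` (DIVERGENCE F3; every identity here is insensitive to the
anchor) and `λ(c_±)` of (1.9) is `λ` at the coarse sites embedded by `Setup.emb`; standing range `k ≤ m + K` of `Setup.Params` wherever block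
geometry (`runSite_blockSite_L`, `siteAvg_eq_blockSum`) is used.  DELIBERATELY NOT HERE: the one-stroke block-sum formula
`(Q'_kλ)(y) = Σ_{x∈B^k(y)} η^dλ(x)` for the composite `siteAvgIter` and the corresponding literal form of (1.20) with the blocks `B^k(b_±)` of order
`k` — they ride with the one-stroke formula (1.18) for `Q_k` (seat p39, row `B5.Eq1.11-1.18`) and are appended here (v1.x) once that file has landed.
Unit `lit-balaban-p38` (literature-prover-lit-balaban-p38-0), 2026-08-21.

v1.1 (same day, append-only; + `import …B5Eq118OneStroke`): §3 = the LITERAL display (1.20) with the sums over the blocks `B^k(b_±)` of order `k`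
(`B5Eq118OneStroke.iterBlock`, seat p39) and the weight `η^d`, `η = L^{−k}` (`Params.eta`): `eq120_blockSum` (general fine factor `c`) and
`eq120_printed` (the printed normalisation `c = η⁻¹`, `A^λ = A − ∂^ηλ`, unit coarse lattice), from `eq120`/`eq120_unit` and p39's one-stroke formula
`B5Eq118OneStroke.eq120` for `Q'_k`; §4 = the two "restrict the gauge transformations" sentences of p. 19 (`fullBondAvg_gaugeShift_of_null`:
`λ = 0` on `T_L^{(1)}` fixes the full average; `bondAvg_gaugeShift_of_null`: `Q'λ = 0` fixes `QA`).
-/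

open scoped BigOperators

namespace Literature.MathematicalPhysics.QuantumFieldTheory.Balaban1983to89

namespace B5Eq120IterProof

open LatticeFieldCalculus

/-! ## 1. Telescoping along signed runs and staircase contours; (1.9) for the full average (1.8) -/

section FullAverage

variable {P : Params} {j : ℕ} {V : Type*} [AddCommGroup V] [Module ℝ V]

/-- TELESCOPING ALONG A SIGNED STRAIGHT RUN: for every `n ∈ ℤ`, `(∂λ)` summed along the run of `n` steps from `x` in the direction `μ`
(backward bonds with a minus sign for `n < 0`) is `c·(λ(x + n e_μ) − λ(x))` (the computation behind (1.9): "`B^λ_c = B_c − L⁻¹(λ(c₊) − λ(c₋))`").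
[cite: Balaban1984PropagatorsI, (1.9) p.19] -/
theorem runSum_grad (c : ℝ) (lam : SiteField P j V) (x : Site P j) (μ : Fin P.d) (n : ℤ) :
    runSum (grad c lam) x μ n = c • (lam (Function.update x μ (x μ + (n : ZMod (P.sitesPerDir j)))) - lam x) := by
  cases n with
  | ofNat n =>
    rw [Int.ofNat_eq_natCast, runSum_ofNat, segSum_grad, Int.cast_natCast]
    rfl
  | negSucc n =>
    -- the backward run: `w t = λ(x − t e_μ)`; the `t`-th summand is `c·(w t − w (t+1))`
    set w : ℕ → V := fun t => lam (Function.update x μ (x μ - (t : ZMod (P.sitesPerDir j)))) with hw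
    have hterm : ∀ t : ℕ,
        grad c lam ⟨Function.update x μ (x μ - ((t + 1 : ℕ) : ZMod (P.sitesPerDir j))), μ⟩ = c • (w t - w (t + 1)) := by
      intro t
      have he : x μ - ((t + 1 : ℕ) : ZMod (P.sitesPerDir j)) + 1 = x μ - (t : ZMod (P.sitesPerDir j)) := by
        push_cast; ring
      simp only [grad, PBond.tgt, Site.shift, Function.update_idem, Function.update_self, hw, he]
    have hsum : runSum (grad c lam) x μ (Int.negSucc n)
        = -∑ t ∈ Finset.range (n + 1), c • (w t - w (t + 1)) := by
      show -(∑ t ∈ Finset.range (n + 1),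
          grad c lam ⟨Function.update x μ (x μ - ((t + 1 : ℕ) : ZMod (P.sitesPerDir j))), μ⟩) = _
      rw [Finset.sum_congr rfl fun t _ => hterm t]
    rw [hsum, ← Finset.smul_sum, Finset.sum_range_sub', Int.cast_negSucc]
    have h0 : w 0 = lam x := by simp [hw]
    rw [h0, ← sub_eq_add_neg, ← smul_neg, neg_sub]

/-- TELESCOPING ALONG THE STAIRCASE `Γ_{y,x}`: `(∂λ)(Γ_{y,x}) = c·(λ(x) − λ(y))` for all sites `y, x` (each of the `d` runs moves one
coordinate of `y` to that of `x`; "`B^λ_c = B_c − L⁻¹(λ(c₊) − λ(c₋))`, (1.9)"). [cite: Balaban1984PropagatorsI, (1.9) p.19] -/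
theorem stairSum_grad (c : ℝ) (lam : SiteField P j V) (y x : Site P j) :
    stairSum (grad c lam) y x = c • (lam x - lam y) := by
  -- `g i = λ` at the corner whose coordinates `≥ i` are those of `x` and `< i` those of `y`
  set g : ℕ → V := fun i => lam (fun ν => if i ≤ ν.val then x ν else y ν) with hg
  have hend : ∀ μ : Fin P.d,
      Function.update (mixSite μ y x) μ (mixSite μ y x μ + (((x μ - y μ).valMinAbs : ℤ) : ZMod (P.sitesPerDir j)))
        = fun ν => if (μ : ℕ) ≤ ν.val then x ν else y ν := by
    intro μ
    funext ν
    by_cases hν : ν = μ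
    · subst hν
      rw [Function.update_self, ZMod.coe_valMinAbs, if_pos le_rfl]
      simp [mixSite]
    · rw [Function.update_of_ne hν]
      simp only [mixSite, Fin.lt_def]
      have : (μ : ℕ) ≠ ν.val := fun h => hν (Fin.ext h.symm)
      by_cases h1 : (μ : ℕ) < ν.val
      · rw [if_pos h1, if_pos h1.le]
      · rw [if_neg h1, if_neg (by omega)]
  have hstart : ∀ μ : Fin P.d, mixSite μ y x = fun ν => if (μ : ℕ) + 1 ≤ ν.val then x ν else y ν := by
    intro μ
    funext ν
    simp only [mixSite, Fin.lt_def]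
    by_cases h1 : (μ : ℕ) < ν.val
    · rw [if_pos h1, if_pos (by omega)]
    · rw [if_neg h1, if_neg (by omega)]
  have hterm : ∀ μ : Fin P.d, runSum (grad c lam) (mixSite μ y x) μ ((x μ - y μ).valMinAbs) = c • (g μ - g (μ + 1)) := by
    intro μ
    rw [runSum_grad, hend μ]
    conv_lhs => rw [hstart μ]
  unfold stairSum
  simp only [hterm, ← Finset.smul_sum]
  rw [Fin.sum_univ_eq_sum_range (fun i => g i - g (i + 1)) P.d, Finset.sum_range_sub']
  have hg0 : g 0 = lam x := by simp [hg]
  have hgd : g P.d = lam y := by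
    simp only [hg]
    congr 1
    funext ν
    rw [if_neg (by have := ν.isLt; omega)]
  rw [hg0, hgd]

omit [Module ℝ V] in
/-- The straight-contour sum is linear in the bond field: `(A − A')([x, x + n e_μ]) = A([…]) − A'([…])` ("`A(Γ) = Σ_{b⊂Γ} A_b`", (1.8)).
[cite: Balaban1984PropagatorsI, (1.8) p.19] -/
theorem segSum_sub (A B : VecField P j V) (x : Site P j) (μ : Fin P.d) (n : ℕ) :
    segSum (fun b => A b - B b) x μ n = segSum A x μ n - segSum B x μ n := by
  simp [segSum, Finset.sum_sub_distrib]

omit [Module ℝ V] in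
/-- The signed run sum is linear in the bond field. [cite: Balaban1984PropagatorsI, (1.8) p.19] -/
theorem runSum_sub (A B : VecField P j V) (x : Site P j) (μ : Fin P.d) (n : ℤ) :
    runSum (fun b => A b - B b) x μ n = runSum A x μ n - runSum B x μ n := by
  cases n with
  | ofNat n => simp [runSum, Finset.sum_sub_distrib]
  | negSucc n =>
    simp only [runSum, Finset.sum_sub_distrib]
    abel

omit [Module ℝ V] in
/-- The staircase-contour sum `A(Γ_{y,x})` is linear in the bond field. [cite: Balaban1984PropagatorsI, (1.8) p.19] -/
theorem stairSum_sub (A B : VecField P j V) (y x : Site P j) :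
    stairSum (fun b => A b - B b) y x = stairSum A y x - stairSum B y x := by
  simp only [stairSum, runSum_sub, Finset.sum_sub_distrib]

/-- The full linear average (1.8) is linear: `\overline{A − A'} = \bar A − \bar A'`. [cite: Balaban1984PropagatorsI, (1.8) p.19] -/
theorem fullBondAvg_sub (A B : VecField P j V) :
    fullBondAvg (fun b => A b - B b) = fun c => fullBondAvg A c - fullBondAvg B c := by
  funext c
  simp only [fullBondAvg, stairSum_sub, segSum_sub, ← smul_sub, ← Finset.sum_sub_distrib]
  congr 1
  refine Finset.sum_congr rfl fun r _ => ?_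
  abel

/-- THE FULL AVERAGE OF A GRADIENT, (1.9): the contour `Γ_{c₋,x} ∪ [x, x(c)] ∪ Γ_{x(c),c₊}` runs from `c₋` to `c₊`, so
`\overline{∂λ}_c = L^{−(d+1)} Σ_{x∈B(c₋)} c·(λ(c₊) − λ(c₋)) = (c/L)(λ(c₊) − λ(c₋))` — the coarse gradient (factor `c/L`) of `λ` at the coarse
sites (embedded by `Setup.emb`; standing range). [cite: Balaban1984PropagatorsI, (1.9) p.19] -/
theorem fullBondAvg_grad (hj : j + 1 ≤ P.m + P.K) (c : ℝ) (lam : SiteField P j V) :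
    fullBondAvg (grad c lam) = grad (c / P.L) (fun y : Site P (j + 1) => lam (emb y)) := by
  funext b
  simp only [fullBondAvg, stairSum_grad, segSum_grad, runSite_blockSite_L hj]
  have hsum : ∀ r : Fin P.d → Fin P.L,
      c • (lam (Site.blockSite b.src r) - lam (emb b.src))
        + c • (lam (Site.blockSite (b.src.shift b.dir) r) - lam (Site.blockSite b.src r))
        - c • (lam (Site.blockSite b.tgt r) - lam (emb b.tgt))
      = c • (lam (emb b.tgt) - lam (emb b.src)) := by
    intro r
    simp only [PBond.tgt]
    module
  simp only [hsum]
  rw [Finset.sum_const, Finset.card_univ, Fintype.card_fun, Fintype.card_fin, Fintype.card_fin, ← Nat.cast_smul_eq_nsmul ℝ,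
    smul_smul, smul_smul]
  simp only [grad]
  have hL : (P.L : ℝ) ≠ 0 := Nat.cast_ne_zero.mpr P.L_pos.ne'
  congr 1
  rw [Nat.cast_pow]
  field_simp
  ring

/-- GAUGE COVARIANCE OF THE FULL LINEAR AVERAGE (1.8), i.e. (1.9): `\overline{A − ∂λ} = \bar A − ∂(λ∘emb)` with the coarse lattice
factor `c/L` ("so fixing the average, we restrict the gauge transformations by the condition `λ(y) = 0`, `y ∈ T_L^{(1)}`, for nonconstant
`λ`", p. 19; standing range). [cite: Balaban1984PropagatorsI, (1.9) p.19] -/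
theorem fullBondAvg_gaugeShift (hj : j + 1 ≤ P.m + P.K) (c : ℝ) (lam : SiteField P j V) (A : VecField P j V) :
    fullBondAvg (gaugeShift c lam A) = gaugeShift (c / P.L) (fun y : Site P (j + 1) => lam (emb y)) (fullBondAvg A) := by
  have hlin : fullBondAvg (gaugeShift c lam A) = fun b => fullBondAvg A b - fullBondAvg (grad c lam) b := by
    rw [← fullBondAvg_sub]
    rfl
  rw [hlin, fullBondAvg_grad hj]
  rfl

/-- **(1.9)** p. 19 [PDF 3], verbatim: *"If we make a gauge transformation `λ`, then for the averaged field `B` we have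
`B^λ_c = B_c − L⁻¹(λ(c₊) − λ(c₋)) = B_c − (∂λ)(c)`"* — typed reading: `B` = the full average (1.8) `fullBondAvg`, fine lattice factor `c`
(`= 1` on the unit lattice `T₁` of the paper, giving the printed `L⁻¹`), `c_± ∈ T_L^{(1)} ⊂ T₁` via `Setup.emb`; standing range.
[cite: Balaban1984PropagatorsI, (1.9) p.19] -/
theorem eq19 (hj : j + 1 ≤ P.m + P.K) (c : ℝ) (lam : SiteField P j V) (A : VecField P j V) (b : PBond P (j + 1)) :
    fullBondAvg (gaugeShift c lam A) b = fullBondAvg A b - (c / P.L) • (lam (emb b.tgt) - lam (emb b.src)) := by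
  rw [fullBondAvg_gaugeShift hj]
  rfl

/-- **(1.13)** p. 19 [PDF 3] in its displayed block-sum form, verbatim: *"`B^λ_c = B_c − L⁻¹(Σ_{x∈B(c₊)} L^{−d}λ(x) − Σ_{x∈B(c₋)} L^{−d}λ(x))
= B_c − L⁻¹((Q'λ)(c₊) − (Q'λ)(c₋)) = B_c − (∂Q'λ)(c)`"* — here `B = QA` (1.11) = `bondAvg A`, fine factor `c` (printed `c = 1`), blocks
`B(y) = Setup.block y` (centred, DIVERGENCE F3); the operator form is `LatticeFieldCalculus.bondAvg_gaugeShift` (unit r18); standing range.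
[cite: Balaban1984PropagatorsI, (1.13) p.19] -/
theorem eq113_blockSum (hj : j + 1 ≤ P.m + P.K) (c : ℝ) (lam : SiteField P j V) (A : VecField P j V) (b : PBond P (j + 1)) :
    bondAvg (gaugeShift c lam A) b
      = bondAvg A b - (c / P.L) • ((((P.L : ℝ) ^ P.d)⁻¹) • ∑ x ∈ block b.tgt, lam x - (((P.L : ℝ) ^ P.d)⁻¹) • ∑ x ∈ block b.src, lam x) := by
  rw [bondAvg_gaugeShift hj, ← siteAvg_eq_blockSum hj, ← siteAvg_eq_blockSum hj]
  rfl

end FullAverage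

/-! ## 2. The `k`-step identities (1.20): `Q_k∂ = ∂Q'_k`, `Q_kA^λ = Q_kA − ∂Q'_kλ` -/

section Iter

variable {P : Params} {V : Type*} [AddCommGroup V] [Module ℝ V]

/-- `Q'_0 = 1` (no averaging step). [cite: Balaban1984PropagatorsI, (1.20) p.20] -/
theorem siteAvgIter_zero (lam : SiteField P 0 V) : siteAvgIter 0 lam = lam := rfl

/-- `Q'_{k+1} = Q' Q'_k`: the site average of order `k+1` is one more block average of the order-`k` one ("a composition of `k`
transformations", p. 20). [cite: Balaban1984PropagatorsI, (1.20) p.20] -/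
theorem siteAvgIter_succ (k : ℕ) (lam : SiteField P 0 V) : siteAvgIter (k + 1) lam = siteAvg (siteAvgIter k lam) := rfl

/-- `Q_0 = 1`. [cite: Balaban1984PropagatorsI, (1.18) p.20] -/
theorem bondAvgIter_zero (A : VecField P 0 V) : bondAvgIter 0 A = A := rfl

/-- `Q_{k+1} = Q Q_k` ((1.16)–(1.18): "a composition of `k` transformations"). [cite: Balaban1984PropagatorsI, (1.18) p.20] -/
theorem bondAvgIter_succ (k : ℕ) (A : VecField P 0 V) : bondAvgIter (k + 1) A = bondAvg (bondAvgIter k A) := rfl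

/-- `Q_k ∂ = ∂ Q'_k` ((1.20): "`Q_kA^λ = Q_kA − ∂Q'_kλ`" applied to `A = 0`): the `k`-fold bond average of a gradient with lattice factor `c`
(`= η⁻¹ = L^k` in print) is the gradient, with the coarse factor `c/L^k` (`= 1` on the unit lattice `T₁^{(k)}`), of the `k`-fold site average;
standing range `k ≤ m + K`. [cite: Balaban1984PropagatorsI, (1.20) p.20] -/
theorem bondAvgIter_grad : ∀ (k : ℕ), k ≤ P.m + P.K → ∀ (c : ℝ) (lam : SiteField P 0 V),
    bondAvgIter k (grad c lam) = grad (c / (P.L : ℝ) ^ k) (siteAvgIter k lam)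
  | 0, _, c, lam => by rw [bondAvgIter_zero, siteAvgIter_zero, pow_zero, div_one]
  | k + 1, hk, c, lam => by
    rw [bondAvgIter_succ, siteAvgIter_succ, bondAvgIter_grad k (by omega) c lam, bondAvg_grad (show k + 1 ≤ P.m + P.K from hk),
      pow_succ, div_div]

/-- **(1.20)** p. 20 [PDF 4], operator form, verbatim: *"we have `Q_kA^λ = Q_kA − ∂Q'_kλ`"* — typed reading: `Q_k = bondAvgIter k`,
`Q'_k = siteAvgIter k` (the `k`-fold composites of `LatticeFieldCalculus`), `A^λ = gaugeShift c λ A = A − ∂λ` with fine factor `c` (`∂^η`,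
`c = η⁻¹ = L^k` in print) and coarse factor `c/L^k` (`= 1`: `b ⊂ T₁^{(k)}` is a bond of the unit lattice); by induction on `k` from the one-step
identity (1.13) `LatticeFieldCalculus.bondAvg_gaugeShift`; standing range `k ≤ m + K`. [cite: Balaban1984PropagatorsI, (1.20) p.20] -/
theorem bondAvgIter_gaugeShift : ∀ (k : ℕ), k ≤ P.m + P.K → ∀ (c : ℝ) (lam : SiteField P 0 V) (A : VecField P 0 V),
    bondAvgIter k (gaugeShift c lam A) = gaugeShift (c / (P.L : ℝ) ^ k) (siteAvgIter k lam) (bondAvgIter k A)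
  | 0, _, c, lam, A => by rw [bondAvgIter_zero, siteAvgIter_zero, bondAvgIter_zero, pow_zero, div_one]
  | k + 1, hk, c, lam, A => by
    rw [bondAvgIter_succ, bondAvgIter_gaugeShift k (by omega) c lam A, bondAvg_gaugeShift (show k + 1 ≤ P.m + P.K from hk),
      ← siteAvgIter_succ, ← bondAvgIter_succ, pow_succ, div_div]

/-- **(1.20)** p. 20 [PDF 4], displayed form, verbatim: *"`(Q_kA^λ)_b = (Q_kA)_b − (Σ_{x∈B^k(b₊)} η^dλ(x) − Σ_{x∈B^k(b₋)} η^dλ(x))`,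
`b ⊂ T₁^{(k)}`, (1.20) or denoting `(Q'_kλ)(y) = Σ_{x∈B^k(y)} η^dλ(x)`, …"* — componentwise, with the block sums written as `(Q'_kλ)(b_±)
= siteAvgIter k λ b_±` and the general factors `c` (fine) / `c/L^k` (coarse); the literal sums over the blocks `B^k(b_±)` of order `k` ride with
the one-stroke formula (1.18) (module docstring); standing range. [cite: Balaban1984PropagatorsI, (1.20) p.20] -/
theorem eq120 {k : ℕ} (hk : k ≤ P.m + P.K) (c : ℝ) (lam : SiteField P 0 V) (A : VecField P 0 V) (b : PBond P k) :
    bondAvgIter k (gaugeShift c lam A) b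
      = bondAvgIter k A b - (c / (P.L : ℝ) ^ k) • (siteAvgIter k lam b.tgt - siteAvgIter k lam b.src) := by
  rw [bondAvgIter_gaugeShift k hk]
  rfl

/-- (1.20) at the PRINTED normalisation: `A` on the `η`-lattice, `η = L^{−k}`, `A^λ = A − ∂^ηλ` (`c = η⁻¹ = L^k`), `Q_kA` on the unit
lattice `T₁^{(k)}`, so the coarse gradient carries no factor: `(Q_kA^λ)_b = (Q_kA)_b − ((Q'_kλ)(b₊) − (Q'_kλ)(b₋))`; standing range.
[cite: Balaban1984PropagatorsI, (1.20) p.20] -/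
theorem eq120_unit {k : ℕ} (hk : k ≤ P.m + P.K) (lam : SiteField P 0 V) (A : VecField P 0 V) (b : PBond P k) :
    bondAvgIter k (gaugeShift ((P.L : ℝ) ^ k) lam A) b
      = bondAvgIter k A b - (siteAvgIter k lam b.tgt - siteAvgIter k lam b.src) := by
  have hL : ((P.L : ℝ) ^ k) ≠ 0 := pow_ne_zero _ (Nat.cast_ne_zero.mpr P.L_pos.ne')
  rw [eq120 hk, div_self hL, one_smul]

/-- **(1.20)**, the closing sentence of p. 20 [PDF 4], verbatim: *"The δ-function `δ(B − Q_kA)` is invariant with respect to gauge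
transformations `λ` satisfying `Q'_kλ = 0`"* — typed reading: `Q'_kλ = 0 ⇒ Q_kA^λ = Q_kA` (any fine factor `c`); standing range.
[cite: Balaban1984PropagatorsI, (1.20) p.20] -/
theorem bondAvgIter_gaugeShift_of_null {k : ℕ} (hk : k ≤ P.m + P.K) (c : ℝ) {lam : SiteField P 0 V}
    (hlam : siteAvgIter k lam = 0) (A : VecField P 0 V) : bondAvgIter k (gaugeShift c lam A) = bondAvgIter k A := by
  rw [bondAvgIter_gaugeShift k hk, hlam]
  funext b
  simp [gaugeShift, grad]

end Iter

/-! ## 3. (v1.1) The literal display (1.20): sums over the blocks `B^k(b_±)` of order `k` with the weight `η^d` -/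

section Literal

variable {P : Params} {V : Type*} [AddCommGroup V] [Module ℝ V]

/-- **(1.20)** p. 20 [PDF 4] LITERALLY, verbatim: *"`(Q_kA^λ)_b = (Q_kA)_b − (Σ_{x∈B^k(b₊)} η^dλ(x) − Σ_{x∈B^k(b₋)} η^dλ(x))`, `b ⊂ T₁^{(k)}`"*
— typed reading: `Q_k = bondAvgIter k`, `B^k(y) = B5Eq118OneStroke.iterBlock k y` (the `L^{kd}` sites of `T^{(0)} = T_η` over `y`, seat p39),
`η^d = (Params.eta k)^d = L^{−kd}`, general fine factor `c` of `A^λ = A − ∂λ` and coarse factor `c/L^k` (printed: `c = η⁻¹`, factor `1`, see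
`eq120_printed`); from `eq120` and the one-stroke formula `B5Eq118OneStroke.eq120` for `Q'_k`; standing range `k ≤ m + K`.
[cite: Balaban1984PropagatorsI, (1.20) p.20] -/
theorem eq120_blockSum {k : ℕ} (hk : k ≤ P.m + P.K) (c : ℝ) (lam : SiteField P 0 V) (A : VecField P 0 V) (b : PBond P k) :
    bondAvgIter k (gaugeShift c lam A) b
      = bondAvgIter k A b - (c / (P.L : ℝ) ^ k) •
          (∑ x ∈ B5Eq118OneStroke.iterBlock k b.tgt, P.eta k ^ P.d • lam x
            - ∑ x ∈ B5Eq118OneStroke.iterBlock k b.src, P.eta k ^ P.d • lam x) := by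
  rw [eq120 hk, B5Eq118OneStroke.eq120 hk, B5Eq118OneStroke.eq120 hk]

/-- **(1.20)** AT THE PRINTED NORMALISATION, verbatim: *"`A^λ = A − ∂^ηλ`, `(Q_kA^λ)_b = (Q_kA)_b − (Σ_{x∈B^k(b₊)} η^dλ(x) − Σ_{x∈B^k(b₋)} η^dλ(x))`,
`b ⊂ T₁^{(k)}`, (1.20)"*: the gauge transformation on the `η`-lattice uses `∂^η` (factor `η⁻¹ = L^k`), the averaged field lives on the UNIT lattice
`T₁^{(k)}`, so no lattice factor multiplies the block sums; `B^k(y) = B5Eq118OneStroke.iterBlock k y`, `η = Params.eta k`; standing range.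
[cite: Balaban1984PropagatorsI, (1.20) p.20] -/
theorem eq120_printed {k : ℕ} (hk : k ≤ P.m + P.K) (lam : SiteField P 0 V) (A : VecField P 0 V) (b : PBond P k) :
    bondAvgIter k (gaugeShift (P.eta k)⁻¹ lam A) b
      = bondAvgIter k A b - (∑ x ∈ B5Eq118OneStroke.iterBlock k b.tgt, P.eta k ^ P.d • lam x
            - ∑ x ∈ B5Eq118OneStroke.iterBlock k b.src, P.eta k ^ P.d • lam x) := by
  have h : (P.eta k)⁻¹ = (P.L : ℝ) ^ k := by
    unfold Params.eta
    rw [inv_pow, inv_inv]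
  rw [h, eq120_unit hk, B5Eq118OneStroke.eq120 hk, B5Eq118OneStroke.eq120 hk]

end Literal

/-! ## 4. (v1.1) "Fixing the average, we restrict the gauge transformations": the residual gauge freedom of (1.9) and (1.13) -/

section Restrict

variable {P : Params} {j : ℕ} {V : Type*} [AddCommGroup V] [Module ℝ V]

/-- (1.9), the sentence following it, p. 19 [PDF 3], verbatim: *"so fixing the average, we restrict the gauge transformations by the condition
`λ(y) = 0`, `y ∈ T_L^{(1)}`, for nonconstant `λ`"* — typed reading: a gauge function vanishing at the coarse sites (`λ ∘ emb = 0`) does not move the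
full average (1.8): `\overline{A − ∂λ} = \bar A`; standing range. [cite: Balaban1984PropagatorsI, (1.9) p.19] -/
theorem fullBondAvg_gaugeShift_of_null (hj : j + 1 ≤ P.m + P.K) (c : ℝ) {lam : SiteField P j V}
    (hlam : ∀ y : Site P (j + 1), lam (emb y) = 0) (A : VecField P j V) : fullBondAvg (gaugeShift c lam A) = fullBondAvg A := by
  rw [fullBondAvg_gaugeShift hj]
  funext b
  simp [gaugeShift, grad, hlam]

/-- (1.13), the sentence following it, p. 19 [PDF 3], verbatim: *"Fixing it we restrict the gauge transformations by the condition `(Q'λ)(y) = 0`"*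
— typed reading: `Q'λ = 0 ⇒ Q(A − ∂λ) = QA` (one level, any fine factor `c`; the `k`-step version is `bondAvgIter_gaugeShift_of_null`); standing
range. [cite: Balaban1984PropagatorsI, (1.13) p.19] -/
theorem bondAvg_gaugeShift_of_null (hj : j + 1 ≤ P.m + P.K) (c : ℝ) {lam : SiteField P j V} (hlam : siteAvg lam = 0)
    (A : VecField P j V) : bondAvg (gaugeShift c lam A) = bondAvg A := by
  rw [bondAvg_gaugeShift hj, hlam]
  funext b
  simp [gaugeShift, grad]

end Restrict

end B5Eq120IterProof

end Literature.MathematicalPhysics.QuantumFieldTheory.Balaban1983to89
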